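import Mathlib
import HarnessLib
import Literature.Probability.MarkovChains.StationaryDistributionExistence

/-!
# Hitting-time equations, the return-time identity and the Random Target Lemma (Levin–Peres–Wilmer §10.2)

HONEST FRAMING: exact (Metropolis-corrected) sampling algorithms for lattice gauge theory; figures
of merit are autocorrelation/cost numbers at stated couplings and volumes; no continuum-physics claim.

Source: D. A. Levin, Y. Peres (with E. L. Wilmer), *Markov Chains and Mixing Times*, 2nd ed.,
AMS 2017 [LevinPeres2017], §1.5.4 Prop. 1.19 (eq. (1.28)) and §10.2 (eq. (10.2), Lemma 10.1 with
its proof, eqs. (10.3)–(10.5), Lemma 10.2 with eqs. (10.6)–(10.7)) and §9.2 Prop. 9.1 (uniqueness of harmonic extensions, maximum principle), pp. 13, 117 and 129–130; the first-step linear system for mean hitting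
times is Norris, *Markov Chains*, CUP 1997 [Norris1997], Thm 1.3.5.  Conventions of this directory:
`IsRowStochastic` (`TotalVariation.lean`), `IsStationary π P` (`MetropolisHastings.lean`),
`IsIrreducible` (`PeskunOrdering.lean`), Lemma 1.16 `LevinPeres2017_lemma_1_16` and
`harmonic_max_step` (`StationaryDistributionExistence.lean`).  Everything is PROVED (0 named facts).

DECLARED SETTING (no trajectory space).  The book's objects are the expected hitting times
`E_a(τ_x)`.  Here, exactly as in the printed proof of Lemma 10.1, only their FIRST-STEP EQUATIONS are
used: a function `h : X → X → ℝ`, read `h a x = E_a(τ_x)`, is an `IsHittingTimeSolution` when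
`h x x = 0` and `h a x = 1 + Σ_y P(a,y) h y x` for `a ≠ x` (eq. (10.3): `(P h_x)(a) = h_x(a) − 1`;
[Norris1997, Thm 1.3.5]).  For an irreducible chain this system has exactly one solution
(`IsHittingTimeSolution.unique`, `exists_isHittingTimeSolution` below), so nothing is lost; the
identification of that solution with `E_a(τ_x)` on the path space is the part NOT formalised here.

* `IsHittingTimeSolution.nonneg` — every solution is `≥ 0` (minimum principle; no irreducibility);
* **eq. (10.4) / PROP. 1.19** `IsHittingTimeSolution.returnTime_identity` — for a stationary
  probability vector `π`: `π(a) · (1 + (P h_a)(a)) = 1`, i.e. `E_a(τ_a⁺) = 1 + (P h_a)(a) = 1/π(a)`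
  [cite: LevinPeres2017, §10.2 eq. (10.4) ("Since `E_a(τ_a⁺) = π(a)⁻¹`", Prop. 1.19 eq. (1.28))].
  DECLARED DEVIATION: the book imports (1.28) from the return-time construction of `π`
  (Prop. 1.14); here the identity is obtained by summing the first-step equations against `π`
  (`Σ_y π(y)[h_a(y) − (P h_a)(y)] = 0` by stationarity), which needs neither irreducibility nor
  `π > 0` — only `πP = π` and `Σ π = 1`;
* **LEMMA 10.1 (Random Target Lemma)** `LevinPeres2017_lemma_10_1` — for an irreducible chain with
  stationary distribution `π`, the target time `t⊙ᵃ = Σ_x E_a(τ_x) π(x)` (eq. (10.2)) does not depend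
  on `a` [cite: LevinPeres2017, §10.2 Lemma 10.1]; proof AS PRINTED: `h := Σ_x π(x) h_x` is
  harmonic by (10.3) + (10.4), hence constant by Lemma 1.16;
* **eq. (10.7)** `IsHittingTimeSolution.triangle` (`E_a(τ_y) ≤ E_a(τ_x) + E_x(τ_y)`, here by the
  minimum principle for functions harmonic off `{x, y}`) and **LEMMA 10.2** `LevinPeres2017_lemma_10_2`
  — `t_hit ≤ 2 max_w E_π(τ_w)` [cite: LevinPeres2017, §10.2 Lemma 10.2, eqs. (10.6)–(10.7)], proof as
  printed ((10.7) averaged over `x ∼ π`, then Lemma 10.1 / (10.5));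
* **PROP. 9.1 (uniqueness part)** `harmonicOff_max_reaches` / `harmonicOff_ge_of_forall_mem` /
  `eq_zero_of_harmonicOff` — the maximum principle for functions harmonic off a set `B` on an
  irreducible chain, proof AS PRINTED [cite: LevinPeres2017, §9.2 Prop. 9.1, Remark 9.2]; hence
  `IsHittingTimeSolution.unique` / `exists_isHittingTimeSolution` — for an irreducible `P` the
  first-step system has exactly one solution [cite: Norris1997, Thm 1.3.5]: uniqueness by Prop. 9.1
  with `B = {x}`, existence because an injective linear endomorphism of `X → ℝ` is surjective (the
  existence half of Prop. 9.1 is a path-space construction, not reproduced).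

Context (cell pub-lqcd, venture LatticeQCDFlow; THEORY-2's hitting / escape-time vocabulary for
topological sectors): `t⊙` and `t_hit` (eq. (10.6)) are the hitting-time parameters that Chapter 10
compares with `t_mix`; this file supplies the algebraic core (10.3)–(10.5) on which those comparisons
rest.  Nothing here is specific to any sampler of the cell.
-/

namespace Literature.Probability.MarkovChains

open Finset Matrix

variable {X : Type*} [Fintype X] [DecidableEq X] {P : Matrix X X ℝ} {π : X → ℝ}

/-- The FIRST-STEP EQUATIONS of the expected hitting times `h a x = E_a(τ_x)`,
`τ_x = min{t ≥ 0 : X_t = x}`: `h x x = 0` and, for `a ≠ x`, `h a x = 1 + Σ_y P(a,y) · h y x`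
(equivalently `(P h_x)(a) = h_x(a) − 1`). [cite: LevinPeres2017, §10.2, proof of Lemma 10.1,
eq. (10.3)] [cite: Norris1997, Thm 1.3.5 (the linear system for mean hitting times)] -/
def IsHittingTimeSolution (P : Matrix X X ℝ) (h : X → X → ℝ) : Prop :=
  (∀ x, h x x = 0) ∧ ∀ a x, a ≠ x → h a x = 1 + ∑ y, P a y * h y x

namespace IsHittingTimeSolution

variable {h : X → X → ℝ}

omit [DecidableEq X] in
/-- `h_x(x) = E_x(τ_x) = 0`. [cite: LevinPeres2017, §10.2, proof of Lemma 10.1 ("using that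
`h_a(a) = 0`")] -/
theorem diag (hh : IsHittingTimeSolution P h) (x : X) : h x x = 0 := hh.1 x

omit [DecidableEq X] in
/-- The first-step equation at `a ≠ x`: `h_x(a) = 1 + Σ_y P(a,y) h_x(y)`. [cite: LevinPeres2017,
§10.2, proof of Lemma 10.1, eq. (10.3)] -/
theorem off_diag (hh : IsHittingTimeSolution P h) {a x : X} (hax : a ≠ x) :
    h a x = 1 + ∑ y, P a y * h y x := hh.2 a x hax

omit [DecidableEq X] in
/-- eq. (10.3) in the book's form: `(P h_x)(a) = h_x(a) − 1` for `x ≠ a`.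
[cite: LevinPeres2017, §10.2 eq. (10.3)] -/
theorem mulVec_apply_of_ne (hh : IsHittingTimeSolution P h) {a x : X} (hax : a ≠ x) :
    (P *ᵥ fun y => h y x) a = h a x - 1 := by
  rw [mulVec, dotProduct, hh.off_diag hax]
  ring

omit [DecidableEq X] in
/-- Mean hitting times are non-negative [cite: Norris1997, Thm 1.3.5 (the mean hitting times form
the minimal NON-NEGATIVE solution of the first-step system)]; in the present finite setting EVERY
solution of the system is non-negative: the minimum of `h · x` over the finite state space can only
be attained at `x`, where it is `0` (minimum principle, cf. [cite: LevinPeres2017, §9.2, proof of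
Prop. 9.1]).  No irreducibility is needed. -/
theorem nonneg (hP : IsRowStochastic P) (hh : IsHittingTimeSolution P h) (a x : X) :
    0 ≤ h a x := by
  obtain ⟨a₀, -, hmin⟩ := exists_min_image (univ : Finset X) (fun b => h b x) ⟨a, mem_univ a⟩
  have hmin' : ∀ b, h a₀ x ≤ h b x := fun b => hmin b (mem_univ b)
  rcases eq_or_ne a₀ x with h0 | h0
  · have := hmin' a
    rw [h0, hh.diag] at this
    exact this
  · -- at a minimiser `a₀ ≠ x`: `h a₀ x = 1 + Σ_y P(a₀,y) h y x ≥ 1 + h a₀ x`, absurd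
    have hge : h a₀ x ≤ ∑ y, P a₀ y * h y x := by
      calc h a₀ x = ∑ y, P a₀ y * h a₀ x := by rw [← sum_mul, hP.2 a₀, one_mul]
        _ ≤ ∑ y, P a₀ y * h y x :=
          sum_le_sum fun y _ => mul_le_mul_of_nonneg_left (hmin' y) (hP.1 a₀ y)
    have := hh.off_diag h0
    linarith

/-- **eq. (10.4) / PROP. 1.19 (return-time identity, Kac).**  If `π` is a stationary probability
vector (`πP = π`, `Σ π = 1`) and `h` solves the first-step equations, then
`π(a) · (1 + Σ_y P(a,y) h y a) = 1`; in the book's words `E_a(τ_a⁺) = 1 + (P h_a)(a)` and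
`E_a(τ_a⁺) = π(a)⁻¹`, so `(P h_a)(a) = 1/π(a) − 1`. [cite: LevinPeres2017, §10.2 eq. (10.4);
§1.5.4 Prop. 1.19 eq. (1.28)]  DECLARED DEVIATION: proved by summing the first-step equations
against `π` (stationarity makes `Σ_y π(y)(h_a(y) − (P h_a)(y))` vanish), not via Prop. 1.14. -/
theorem returnTime_identity (hπ : IsStationary π P) (hπ1 : ∑ x, π x = 1)
    (hh : IsHittingTimeSolution P h) (a : X) :
    π a * (1 + ∑ y, P a y * h y a) = 1 := by
  set S : ℝ := ∑ y, P a y * h y a with hS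
  -- stationarity: `Σ_y π(y) (P h_a)(y) = Σ_z π(z) h_a(z)`
  have hstat : ∑ y, π y * ∑ z, P y z * h z a = ∑ z, π z * h z a := by
    calc ∑ y, π y * ∑ z, P y z * h z a = ∑ y, ∑ z, π y * P y z * h z a := by
            refine sum_congr rfl fun y _ => ?_
            rw [mul_sum]
            refine sum_congr rfl fun z _ => ?_
            ring
      _ = ∑ z, ∑ y, π y * P y z * h z a := sum_comm
      _ = ∑ z, (∑ y, π y * P y z) * h z a := by
            refine sum_congr rfl fun z _ => ?_
            rw [sum_mul]
      _ = ∑ z, π z * h z a := by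
            refine sum_congr rfl fun z _ => ?_
            rw [hπ z]
  -- termwise: `π(y)(h_a(y) − (P h_a)(y)) = π(y) − [y = a](π(a) + π(a) S)`
  have hterm : ∀ y, π y * (h y a - ∑ z, P y z * h z a)
      = π y - if y = a then π a + π a * S else 0 := by
    intro y
    by_cases hy : y = a
    · subst hy
      rw [if_pos rfl, hh.diag, ← hS]
      ring
    · rw [if_neg hy, hh.off_diag hy]
      ring
  have hzero : ∑ y, π y * (h y a - ∑ z, P y z * h z a) = 0 := by
    simp_rw [mul_sub]
    rw [sum_sub_distrib, hstat, sub_self]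
  rw [sum_congr rfl fun y _ => hterm y, sum_sub_distrib, sum_ite_eq' univ a, if_pos (mem_univ a),
    hπ1] at hzero
  linarith

/-- Corollary of (10.4): a state carrying a solution has `π(a) ≠ 0` as soon as `Σ π = 1`
(indeed `π(a) · E_a(τ_a⁺) = 1`). [cite: LevinPeres2017, §1.5.4 Prop. 1.19 ("in particular …
`π(z) > 0`" is how (1.28) is used)] -/
theorem stationary_ne_zero (hπ : IsStationary π P) (hπ1 : ∑ x, π x = 1)
    (hh : IsHittingTimeSolution P h) (a : X) : π a ≠ 0 := by
  intro h0
  have := hh.returnTime_identity hπ hπ1 a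
  rw [h0, zero_mul] at this
  exact zero_ne_one this

end IsHittingTimeSolution

/-- The target time `t⊙ᵃ = Σ_x E_a(τ_x) π(x)` of eq. (10.2), written for a solution `h` of the
first-step equations (`h a x = E_a(τ_x)`). [cite: LevinPeres2017, §10.2 eq. (10.2)] -/
def targetTime (π : X → ℝ) (h : X → X → ℝ) (a : X) : ℝ := ∑ x, h a x * π x

omit [DecidableEq X] in
/-- Unfolding of `targetTime`: `t⊙ᵃ = Σ_x E_a(τ_x) π(x)`. [cite: LevinPeres2017, §10.2 eq. (10.2)] -/
theorem targetTime_def (π : X → ℝ) (h : X → X → ℝ) (a : X) :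
    targetTime π h a = ∑ x, h a x * π x := rfl

/-- **LEMMA 10.1 (Random Target Lemma).**  For an irreducible Markov chain on the state space `X`
with stationary distribution `π`, the target time `t⊙ᵃ = Σ_x E_a(τ_x) π(x)` does not depend on
`a ∈ X`. [cite: LevinPeres2017, §10.2 Lemma 10.1]  Proof as printed: with `h := Σ_x π(x) h_x`,
(10.3) and (10.4) give `(P h)(a) = Σ_{x ≠ a} (h_x(a) − 1) π(x) + π(a)(1/π(a) − 1) = h(a)`
(using `h_a(a) = 0`), so `h` is harmonic and Lemma 1.16 makes it constant. -/
theorem LevinPeres2017_lemma_10_1 (hP : IsRowStochastic P) (hirr : IsIrreducible P)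
    (hπ : IsStationary π P) (hπ1 : ∑ x, π x = 1) {h : X → X → ℝ} (hh : IsHittingTimeSolution P h)
    (a b : X) : targetTime π h a = targetTime π h b := by
  -- the function `g(a) = Σ_x π(x) h_x(a)` is harmonic
  set g : X → ℝ := fun c => ∑ x, π x * h c x with hg
  have hharm : P *ᵥ g = g := by
    funext c
    rw [mulVec, dotProduct]
    -- `(P g)(c) = Σ_x π(x) (P h_x)(c)`
    have hswap : ∑ y, P c y * g y = ∑ x, π x * ∑ y, P c y * h y x := by
      calc ∑ y, P c y * g y = ∑ y, ∑ x, P c y * (π x * h y x) := by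
              refine sum_congr rfl fun y _ => ?_
              rw [hg, mul_sum]
        _ = ∑ x, ∑ y, P c y * (π x * h y x) := sum_comm
        _ = ∑ x, π x * ∑ y, P c y * h y x := by
              refine sum_congr rfl fun x _ => ?_
              rw [mul_sum]
              refine sum_congr rfl fun y _ => ?_
              ring
    -- termwise (10.3) / (10.4): `π(x)(P h_x)(c) = π(x) h_x(c) − π(x) + [x = c]`
    have hterm : ∀ x, π x * ∑ y, P c y * h y x = π x * h c x - π x + if x = c then 1 else 0 := by
      intro x
      by_cases hx : x = c
      · subst hx
        have := hh.returnTime_identity hπ hπ1 x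
        rw [if_pos rfl, hh.diag]
        linarith
      · rw [if_neg hx, hh.off_diag (Ne.symm hx)]
        ring
    rw [hswap, sum_congr rfl fun x _ => hterm x, sum_add_distrib, sum_sub_distrib,
      sum_ite_eq' univ c, if_pos (mem_univ c), hπ1]
    simp only [hg]
    ring
  have hconst := LevinPeres2017_lemma_1_16 hP hirr hharm a b
  simp only [hg] at hconst
  rw [targetTime_def, targetTime_def]
  calc ∑ x, h a x * π x = ∑ x, π x * h a x := sum_congr rfl fun x _ => mul_comm _ _
    _ = ∑ x, π x * h b x := hconst
    _ = ∑ x, h b x * π x := sum_congr rfl fun x _ => mul_comm _ _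

/-- eq. (10.5): since `t⊙` does not depend on the starting state,
`t⊙ = Σ_{x,y} π(x) π(y) E_x(τ_y) (= E_π(τ_π))`. [cite: LevinPeres2017, §10.2 eq. (10.5)] -/
theorem LevinPeres2017_eq_10_5 (hP : IsRowStochastic P) (hirr : IsIrreducible P)
    (hπ : IsStationary π P) (hπ1 : ∑ x, π x = 1) {h : X → X → ℝ} (hh : IsHittingTimeSolution P h)
    (a : X) : targetTime π h a = ∑ x, ∑ y, π x * π y * h x y := by
  have hx : ∀ x, ∑ y, π x * π y * h x y = π x * targetTime π h a := by
    intro x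
    rw [LevinPeres2017_lemma_10_1 hP hirr hπ hπ1 hh a x, targetTime_def, mul_sum]
    refine sum_congr rfl fun y _ => ?_
    ring
  rw [sum_congr rfl fun x _ => hx x, ← sum_mul, hπ1, one_mul]

/-! ## Uniqueness and existence of the solution for an irreducible chain -/

omit [DecidableEq X] in
/-- Maximum principle for a function harmonic OFF a set `B` (the uniqueness half of PROP. 9.1): if
`u ≤ M` everywhere, `u(a) = M`, `u` is harmonic at every state outside `B`, and some state of `B` is
accessible from `a`, then the maximum `M` is attained ON `B` — maximisers propagate along steps with
`P(x,y) > 0` ("we infer that `y ∈ A`") until the path first meets `B`. [cite: LevinPeres2017, §9.2,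
proof of Prop. 9.1 (uniqueness; Remark 9.2: the argument of Lemma 1.16)] -/
theorem harmonicOff_max_reaches [DecidableEq X] (hP : IsRowStochastic P) {u : X → ℝ} {B : Set X}
    {M : ℝ} (hle : ∀ y, u y ≤ M) (hharm : ∀ a, a ∉ B → u a = ∑ y, P a y * u y) {x : X}
    (hxB : x ∈ B) : ∀ n (a : X), u a = M → 0 < (P ^ n) a x → ∃ b ∈ B, u b = M := by
  intro n
  induction n with
  | zero =>
    intro a ha hpos
    by_cases haB : a ∈ B
    · exact ⟨a, haB, ha⟩
    · have hne : a ≠ x := fun h => haB (h ▸ hxB)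
      rw [pow_zero, one_apply_ne hne] at hpos
      exact absurd hpos (lt_irrefl 0)
  | succ n ih =>
    intro a ha hpos
    by_cases haB : a ∈ B
    · exact ⟨a, haB, ha⟩
    · rw [pow_succ', mul_apply] at hpos
      obtain ⟨w, -, hw⟩ := exists_lt_of_sum_lt (by simpa using hpos :
        ∑ w, (0 : ℝ) < ∑ w, P a w * (P ^ n) w x)
      have haw : 0 < P a w := by
        rcases (hP.1 a w).lt_or_eq with h1 | h1
        · exact h1
        · rw [← h1, zero_mul] at hw
          exact absurd hw (lt_irrefl 0)
      have hwn : 0 < (P ^ n) w x := by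
        rcases (Matrix.pow_apply_nonneg hP.1 n w x).lt_or_eq with h1 | h1
        · exact h1
        · rw [← h1, mul_zero] at hw
          exact absurd hw (lt_irrefl 0)
      exact ih w (harmonic_max_step hP hle ha (hharm a haB) haw) hwn

/-- Minimum principle on an IRREDUCIBLE chain: a function harmonic off a set `B ∋ x` is bounded below
by any lower bound of its values on `B` ("Applying this argument to `−g` shows that `min g ≥ 0`").
[cite: LevinPeres2017, §9.2, proof of Prop. 9.1 (uniqueness part)] -/
theorem harmonicOff_ge_of_forall_mem (hP : IsRowStochastic P) (hirr : IsIrreducible P) {u : X → ℝ}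
    {B : Set X} {x : X} (hxB : x ∈ B) (hharm : ∀ a, a ∉ B → u a = ∑ y, P a y * u y) {m : ℝ}
    (hm : ∀ b ∈ B, m ≤ u b) (a : X) : m ≤ u a := by
  obtain ⟨a₀, -, hmx⟩ := exists_max_image (univ : Finset X) (fun c => -u c) ⟨a, mem_univ a⟩
  have hle : ∀ y, -u y ≤ -u a₀ := fun y => hmx y (mem_univ y)
  have hharm' : ∀ c, c ∉ B → -u c = ∑ y, P c y * -u y := by
    intro c hc
    rw [hharm c hc, ← sum_neg_distrib]
    exact sum_congr rfl fun y _ => by ring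
  obtain ⟨n, hn⟩ := hirr a₀ x
  obtain ⟨b, hbB, hb⟩ := harmonicOff_max_reaches hP hle hharm' hxB n a₀ rfl hn
  have h1 := hle a
  have h2 := hm b hbB
  linarith

/-- **PROP. 9.1, uniqueness part, for `B = {x}`:** a function that vanishes at `x` and is harmonic at
every other state of an IRREDUCIBLE chain is identically zero ("`g` harmonic on `X ∖ B` and `g = 0` on
`B` … whence `g ≡ 0` on `X`"). [cite: LevinPeres2017, §9.2 Prop. 9.1 (uniqueness of the harmonic
extension)] -/
theorem eq_zero_of_harmonicOff (hP : IsRowStochastic P) (hirr : IsIrreducible P) {u : X → ℝ}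
    {x : X} (hx : u x = 0) (hharm : ∀ a, a ≠ x → u a = ∑ y, P a y * u y) : u = 0 := by
  have hB : ∀ a, a ∉ ({x} : Set X) → u a = ∑ y, P a y * u y :=
    fun a ha => hharm a (by simpa using ha)
  have hB' : ∀ a, a ∉ ({x} : Set X) → -u a = ∑ y, P a y * -u y := by
    intro a ha
    rw [hB a ha, ← sum_neg_distrib]
    exact sum_congr rfl fun y _ => by ring
  funext a
  have h1 := harmonicOff_ge_of_forall_mem hP hirr (Set.mem_singleton x) hB
    (m := 0) (fun b hb => by rw [Set.mem_singleton_iff.1 hb, hx]) a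
  have h2 := harmonicOff_ge_of_forall_mem hP hirr (Set.mem_singleton x) hB'
    (m := 0) (fun b hb => by simp [Set.mem_singleton_iff.1 hb, hx]) a
  simp only [Pi.zero_apply]
  linarith

/-- **Uniqueness.**  On an irreducible chain the first-step equations have at most one solution
(so `IsHittingTimeSolution P h` pins `h a x` down to `E_a(τ_x)`): the difference of two solutions is
harmonic on `X ∖ {x}` and vanishes at `x`, hence is `0` by Prop. 9.1. [cite: LevinPeres2017, §9.2
Prop. 9.1 (uniqueness of the extension harmonic off `B`, here `B = {x}`)] [cite: Norris1997,
Thm 1.3.5 (the first-step system for mean hitting times)] -/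
theorem IsHittingTimeSolution.unique (hP : IsRowStochastic P) (hirr : IsIrreducible P)
    {h h' : X → X → ℝ} (hh : IsHittingTimeSolution P h) (hh' : IsHittingTimeSolution P h') :
    h = h' := by
  funext a x
  have hu := eq_zero_of_harmonicOff hP hirr (u := fun b => h b x - h' b x) (x := x)
    (by show h x x - h' x x = 0; rw [hh.diag, hh'.diag, sub_zero]) (by
      intro b hb
      show h b x - h' b x = ∑ y, P b y * (h y x - h' y x)
      rw [hh.off_diag hb, hh'.off_diag hb]
      have : ∀ y, P b y * (h y x - h' y x) = P b y * h y x - P b y * h' y x := fun y => by ring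
      rw [sum_congr rfl fun y _ => this y, sum_sub_distrib]
      ring)
  have := congrFun hu a
  simp only [Pi.zero_apply] at this
  linarith

/-- **Existence.**  On an irreducible chain the first-step equations have a solution (hence exactly
one) [cite: Norris1997, Thm 1.3.5 (the mean hitting times solve the system)].  DECLARED DEVIATION
(no path space): the linear map `u ↦ (u(x); u(a) − (Pu)(a), a ≠ x)` of `X → ℝ` is injective by the
uniqueness part of [cite: LevinPeres2017, §9.2 Prop. 9.1], hence surjective (rank–nullity on the
finite-dimensional space `X → ℝ`). -/
theorem exists_isHittingTimeSolution (hP : IsRowStochastic P) (hirr : IsIrreducible P) :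
    ∃ h : X → X → ℝ, IsHittingTimeSolution P h := by
  -- one linear system per target `x`
  have hx : ∀ x : X, ∃ u : X → ℝ, u x = 0 ∧ ∀ a, a ≠ x → u a = 1 + ∑ y, P a y * u y := by
    intro x
    let L : (X → ℝ) →ₗ[ℝ] (X → ℝ) :=
      { toFun := fun u a => if a = x then u x else u a - ∑ y, P a y * u y
        map_add' := by
          intro u v
          funext a
          by_cases ha : a = x
          · simp [ha]
          · simp only [ha, if_false, Pi.add_apply]
            rw [show (∑ y, P a y * (u y + v y)) = ∑ y, P a y * u y + ∑ y, P a y * v y by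
              rw [← sum_add_distrib]; exact sum_congr rfl fun y _ => by ring]
            ring
        map_smul' := by
          intro c u
          funext a
          by_cases ha : a = x
          · simp [ha]
          · simp only [ha, if_false, Pi.smul_apply, smul_eq_mul, RingHom.id_apply]
            rw [show (∑ y, P a y * (c * u y)) = c * ∑ y, P a y * u y by
              rw [mul_sum]; exact sum_congr rfl fun y _ => by ring]
            ring }
    have hLapp : ∀ (u : X → ℝ) a, L u a = if a = x then u x else u a - ∑ y, P a y * u y :=
      fun u a => rfl
    have hinj : Function.Injective L := by
      intro u v huv
      have hw : (fun a => u a - v a) = 0 := by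
        refine eq_zero_of_harmonicOff hP hirr (x := x) ?_ ?_
        · have := congrFun huv x
          rw [hLapp, hLapp, if_pos rfl, if_pos rfl] at this
          show u x - v x = 0
          linarith
        · intro a ha
          have := congrFun huv a
          rw [hLapp, hLapp, if_neg ha, if_neg ha] at this
          show u a - v a = ∑ y, P a y * (u y - v y)
          have hsplit : ∑ y, P a y * (u y - v y) = ∑ y, P a y * u y - ∑ y, P a y * v y := by
            rw [← sum_sub_distrib]; exact sum_congr rfl fun y _ => by ring
          rw [hsplit]
          linarith
      funext a
      have := congrFun hw a
      simp only [Pi.zero_apply] at this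
      linarith
    have hsurj : Function.Surjective L := LinearMap.surjective_of_injective hinj
    obtain ⟨u, hu⟩ := hsurj fun a => if a = x then 0 else 1
    refine ⟨u, ?_, ?_⟩
    · have := congrFun hu x
      rw [hLapp, if_pos rfl] at this
      simpa using this
    · intro a ha
      have := congrFun hu a
      rw [hLapp, if_neg ha] at this
      simp only [ha, if_false] at this
      linarith
  choose u hu using hx
  exact ⟨fun a x => u x a, fun x => (hu x).1, fun a x hax => (hu x).2 a hax⟩

/-! ## The triangle inequality (10.7) and Lemma 10.2 -/

/-- eq. (10.7) in first-step form: `E_a(τ_y) ≤ E_a(τ_x) + E_x(τ_y)` ("we can insist that the chain go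
from `a` to `y` via" `x`). [cite: LevinPeres2017, §10.2, proof of Lemma 10.2, eq. (10.7)]  DECLARED
DEVIATION: the book argues on the path space; here `u(b) = h_x(b) + h_y(x) − h_y(b)` is harmonic off
`{x, y}`, `u(x) = 0`, `u(y) = h_x(y) + h_y(x) ≥ 0`, and the minimum principle on the irreducible chain
gives `u ≥ 0`. -/
theorem IsHittingTimeSolution.triangle (hP : IsRowStochastic P) (hirr : IsIrreducible P)
    {h : X → X → ℝ} (hh : IsHittingTimeSolution P h) (a x y : X) : h a y ≤ h a x + h x y := by
  rcases eq_or_ne x y with rfl | hxy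
  · rw [hh.diag, add_zero]
  set u : X → ℝ := fun b => h b x + h x y - h b y with hu
  have hharm : ∀ b, b ∉ ({x, y} : Set X) → u b = ∑ z, P b z * u z := by
    intro b hb
    simp only [Set.mem_insert_iff, Set.mem_singleton_iff, not_or] at hb
    have e1 := hh.off_diag hb.1
    have e2 := hh.off_diag hb.2
    have hsplit : ∑ z, P b z * u z
        = ∑ z, P b z * h z x + (∑ z, P b z) * h x y - ∑ z, P b z * h z y := by
      rw [sum_mul, ← sum_add_distrib, ← sum_sub_distrib]
      exact sum_congr rfl fun z _ => by simp only [hu]; ring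
    rw [hsplit, hP.2 b, one_mul]
    simp only [hu]
    linarith
  have hux : u x = 0 := by simp only [hu, hh.diag]; ring
  have huy : 0 ≤ u y := by
    simp only [hu, hh.diag, sub_zero]
    exact add_nonneg (hh.nonneg hP y x) (hh.nonneg hP x y)
  have hmin : ∀ b ∈ ({x, y} : Set X), (0 : ℝ) ≤ u b := by
    intro b hb
    simp only [Set.mem_insert_iff, Set.mem_singleton_iff] at hb
    rcases hb with rfl | rfl
    · rw [hux]
    · exact huy
  have := harmonicOff_ge_of_forall_mem hP hirr (B := ({x, y} : Set X)) (Set.mem_insert x {y})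
    hharm hmin a
  simp only [hu] at this
  linarith

/-- **LEMMA 10.2.**  For an irreducible Markov chain with stationary distribution `π`,
`t_hit ≤ 2 max_w E_π(τ_w)` (eq. (10.6): `t_hit = max_{x,y} E_x(τ_y)`; `E_π(τ_w) = Σ_x π(x) E_x(τ_w)`),
stated for any common upper bound `M` of the `E_π(τ_w)`: every `E_a(τ_y) ≤ 2M`.
[cite: LevinPeres2017, §10.2 Lemma 10.2]  Proof as printed: `E_a(τ_y) ≤ E_a(τ_π) + E_π(τ_y)`
((10.7) averaged over `x ∼ π`) and `E_a(τ_π) = E_π(τ_π) ≤ max_w E_π(τ_w)` by Lemma 10.1 / eq. (10.5). -/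
theorem LevinPeres2017_lemma_10_2 (hP : IsRowStochastic P) (hirr : IsIrreducible P)
    (hπ : IsStationary π P) (hπ1 : ∑ x, π x = 1) (hπ0 : ∀ x, 0 ≤ π x) {h : X → X → ℝ}
    (hh : IsHittingTimeSolution P h) {M : ℝ} (hM : ∀ w, ∑ x, π x * h x w ≤ M) (a y : X) :
    h a y ≤ 2 * M := by
  -- (10.7) averaged over the random intermediate state `x ∼ π`
  have h1 : h a y ≤ targetTime π h a + ∑ x, π x * h x y := by
    calc h a y = ∑ x, π x * h a y := by rw [← sum_mul, hπ1, one_mul]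
      _ ≤ ∑ x, π x * (h a x + h x y) :=
          sum_le_sum fun x _ => mul_le_mul_of_nonneg_left (hh.triangle hP hirr a x y) (hπ0 x)
      _ = targetTime π h a + ∑ x, π x * h x y := by
          rw [targetTime_def, ← sum_add_distrib]
          exact sum_congr rfl fun x _ => by ring
  -- `E_a(τ_π) = E_π(τ_π) = Σ_w π(w) E_π(τ_w) ≤ M`
  have h2 : targetTime π h a ≤ M := by
    rw [LevinPeres2017_eq_10_5 hP hirr hπ hπ1 hh a]
    calc ∑ x, ∑ w, π x * π w * h x w = ∑ w, π w * ∑ x, π x * h x w := by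
            rw [sum_comm]
            refine sum_congr rfl fun w _ => ?_
            rw [mul_sum]
            exact sum_congr rfl fun x _ => by ring
      _ ≤ ∑ w, π w * M := sum_le_sum fun w _ => mul_le_mul_of_nonneg_left (hM w) (hπ0 w)
      _ = M := by rw [← sum_mul, hπ1, one_mul]
  have h3 := hM y
  linarith

end Literature.Probability.MarkovChains
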